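import Summits.HubbardSuperconductivity.HubbardSuperconductivity.Theorems.BalabanIRBirBdGPhaseCoercivityNambu
import Summits.HubbardSuperconductivity.HubbardSuperconductivity.Theorems.BalabanIRBirBdGPhaseCoercivityModes

/-!
# Route BalabanIR — crux 3 `BirBdGPhaseCoercivity` (item `stmt-HubbardSuperconductivity-2081`):
# the universal FIRST-ORDER (variational) upper bound on the phase-rigidity deficit

The crux asks for a LOWER bound `Σ|λ(Hb(0))| - Σ|λ(Hb(θ))| ≥ c₀ Σ_{⟨xy⟩}(1 - cos(θ_x - θ_y))`.
This file proves the complementary UPPER bound, valid for every parameter point `μ ∈ (-4,4)`,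
`Δ₁Δ₂ ≠ 0`, every side `L ≥ 3`, every texture `θ` and every reference angle `α`
(`deficit_le_condensation`):

  `Σ_i|λ_i(Hb(0))| - Σ_i|λ_i(Hb(θ))| ≤ 2 (Σ_k |Δ_k|²/E_k) · (1 - L⁻² Σ_x cos(θ_x - α))`,

`Δ_k = 2Δ₁(cos p₀ - cos p₁) - 4iΔ₂ sin p₀ sin p₁`, `E_k = √(ξ_k² + |Δ_k|²)` — the remark
"`S(θ) ≥ S(0) - 2κ(L² - |Σ_x e^{iθ_x}|)`" of the crux idea `sqrt-concavity-multiplier`, as a theorem.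
MECHANISM (`deficit_le_re_trace_first_order`): `‖Hb(0)‖₁ ≤ Tr M` for the frozen metric
`M = |Hb(0)|` (metric majorant of file `…TraceNorm`), `‖Hb(θ)‖₁ ≥ Re Tr (Hb(θ) · Hb(α) M⁻¹)`
(unitary minorant at `sgn Hb(α)`; `|Hb(α)| = |Hb(0)| = M`), and in the plane-wave basis
(`firstOrder_re_trace`) only the diagonal momentum entries `D^_{kk} = Δ_k L⁻² Σ_x e^{iθ_x}` of the
pairing block meet `sgn Hb(α)`. Consequences (ceiling `c₀ ≤ κ_L/4 ≤ |Δ₁| + |Δ₂|` on the crux's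
constant via the staggered texture) are in file `…Ceiling`.

References: R. Bhatia, *Matrix Analysis* (1997) §IV.2; crux ideas `sqrt-concavity-multiplier`,
`frozen-nambu-metric` (Cruxes/BirBdGPhaseCoercivity/Ideas). No definition is introduced.
-/

noncomputable section

namespace Summit.HubbardSuperconductivity.HubbardSuperconductivity.Theorems

namespace BirBdG

open Matrix Finset Literature.Probability.LatticeModels
open scoped ComplexConjugate ComplexOrder

section Abstract

variable {n : Type*} [Fintype n] [DecidableEq n]

/-- **Variational (first-order) upper bound on the trace-norm deficit.** Let `M ≻ 0` with
`M² = X₀²` (so `Tr M = ‖X₀‖₁`), and let `X₁` be Hermitian with `X₁ M = M X₁`, `M² = X₁²`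
(so `X₁ M⁻¹ = sgn X₁` is unitary). Then for every Hermitian `X`,
`‖X₀‖₁ - ‖X‖₁ ≤ Re Tr ((X₁ - X) X₁ M⁻¹)`: the metric majorant at `G = M⁻¹` for `X₀` and the
unitary minorant at `V = X₁ M⁻¹` for `X` (Bhatia, *Matrix Analysis* §IV.2). With `X₁ = X₀` this is
the tangent (first-order perturbation) bound `‖X₀‖₁ - ‖X₀ + V‖₁ ≤ -Re Tr (V sgn X₀)`. [folklore] -/
theorem deficit_le_re_trace_first_order (X₀ X₁ X M : Matrix n n ℂ) (hX₀ : X₀.IsHermitian)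
    (hX₁ : X₁.IsHermitian) (hX : X.IsHermitian) (hM : M.PosDef) (hsq₀ : M * M = X₀ * X₀)
    (hcomm₁ : X₁ * M = M * X₁) (hsq₁ : M * M = X₁ * X₁) :
    ∑ i, |hX₀.eigenvalues i| - ∑ i, |hX.eigenvalues i| ≤ ((X₁ - X) * (X₁ * M⁻¹)).trace.re := by
  have hMdet : IsUnit M.det := (Matrix.isUnit_iff_isUnit_det M).1 hM.isUnit
  have hMM : M * M⁻¹ = 1 := Matrix.mul_nonsing_inv M hMdet
  have hMM' : M⁻¹ * M = 1 := Matrix.nonsing_inv_mul M hMdet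
  have hMi : M⁻¹.IsHermitian := hM.isHermitian.inv
  -- upper bound for `X₀` with `G = M⁻¹`: `‖X₀‖₁ ≤ Re Tr M`
  have hup := sum_abs_eigenvalues_le_metric_majorant X₀ M⁻¹ hX₀ hM.inv
  rw [Matrix.nonsing_inv_nonsing_inv M hMdet] at hup
  have hGX : M⁻¹ * (X₀ * X₀) = M := by
    rw [← hsq₀, ← Matrix.mul_assoc, hMM', Matrix.one_mul]
  rw [hGX] at hup
  -- lower bound for `X` with the unitary `V = X₁ M⁻¹`
  have hcomm' : M⁻¹ * X₁ = X₁ * M⁻¹ := by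
    calc M⁻¹ * X₁ = M⁻¹ * X₁ * (M * M⁻¹) := by rw [hMM, Matrix.mul_one]
      _ = M⁻¹ * (X₁ * M) * M⁻¹ := by simp only [Matrix.mul_assoc]
      _ = M⁻¹ * (M * X₁) * M⁻¹ := by rw [hcomm₁]
      _ = X₁ * M⁻¹ := by rw [← Matrix.mul_assoc, hMM', Matrix.one_mul]
  have hV : X₁ * M⁻¹ ∈ Matrix.unitaryGroup n ℂ := by
    rw [Matrix.mem_unitaryGroup_iff']
    rw [star_eq_conjTranspose, Matrix.conjTranspose_mul, hMi.eq, hX₁.eq]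
    calc M⁻¹ * X₁ * (X₁ * M⁻¹) = M⁻¹ * (X₁ * X₁) * M⁻¹ := by simp only [Matrix.mul_assoc]
      _ = M⁻¹ * (M * M) * M⁻¹ := by rw [hsq₁]
      _ = 1 := by rw [← Matrix.mul_assoc, hMM', Matrix.one_mul, hMM]
  have hlow := re_trace_mul_unitary_le_sum_abs_eigenvalues X (X₁ * M⁻¹) hX hV
  -- `Tr (X V) = Tr M - Tr ((X₁ - X) V)`
  have hX₁V : X₁ * (X₁ * M⁻¹) = M := by
    rw [← Matrix.mul_assoc, ← hsq₁, Matrix.mul_assoc, hMM, Matrix.mul_one]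
  have hsplit : (X * (X₁ * M⁻¹)).trace = M.trace - ((X₁ - X) * (X₁ * M⁻¹)).trace := by
    rw [Matrix.sub_mul, Matrix.trace_sub, hX₁V]
    ring
  rw [hsplit, Complex.sub_re] at hlow
  linarith

end Abstract

section Transfer

variable {m : Type*} [Fintype m] [DecidableEq m] {W : Matrix m m ℂ} {N : ℕ}

omit [DecidableEq m] in
/-- `(A - B)^ = A^ - B^`. [folklore] -/
theorem hat_sub' (A B : Matrix m m ℂ) :
    (N : ℂ)⁻¹ • (W * (A - B) * Wᴴ) = (N : ℂ)⁻¹ • (W * A * Wᴴ) - (N : ℂ)⁻¹ • (W * B * Wᴴ) := by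
  rw [Matrix.mul_sub, Matrix.sub_mul, smul_sub]

omit [Fintype m] [DecidableEq m] in
/-- Blockwise subtraction. [folklore] -/
theorem fromBlocks_sub' (A B C D A' B' C' D' : Matrix m m ℂ) :
    Matrix.fromBlocks A B C D - Matrix.fromBlocks A' B' C' D' =
      Matrix.fromBlocks (A - A') (B - B') (C - C') (D - D') := by
  rw [sub_eq_add_neg, Matrix.fromBlocks_neg, Matrix.fromBlocks_add]
  simp only [← sub_eq_add_neg]

/-- Trace against a diagonal matrix on the right: `Tr (P * diagonal c) = Σ_k P_{kk} c_k`. [folklore] -/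
theorem trace_mul_diagonal' (P : Matrix m m ℂ) (c : m → ℂ) :
    (P * diagonal c).trace = ∑ k, P k k * c k := by
  simp only [Matrix.trace, Matrix.diag_apply, Matrix.mul_diagonal]

/-- **The first-order trace in momentum space.** With the frozen metric `M = N⁻¹ W₂ᴴ (E ⊕ E) W₂`
(`E` nowhere zero), a reference `X₁` of plane-wave form `[[ξ, Δ₀], [conj Δ₀, -ξ]]` (diagonal blocks)
and any `X` of plane-wave form `[[ξ, D^], [D^ᴴ, -ξ]]`:
`Re Tr ((X₁ - X) X₁ M⁻¹) = 2 Σ_k (|Δ₀(k)|² - Re (conj Δ₀(k) · D^_{kk})) / E_k` — only the DIAGONAL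
momentum entries of the pairing block enter. [folklore] -/
theorem firstOrder_re_trace (hN : N ≠ 0) (h1 : Wᴴ * W = (N : ℂ) • (1 : Matrix m m ℂ))
    (h2 : W * Wᴴ = (N : ℂ) • (1 : Matrix m m ℂ)) (ξ E : m → ℝ) (Δ₀ : m → ℂ)
    (hEne : ∀ k, E k ≠ 0)
    (X₁ X : Matrix (m ⊕ m) (m ⊕ m) ℂ) (Dh : Matrix m m ℂ)
    (hX₁ : (N : ℂ)⁻¹ • (Matrix.fromBlocks W 0 0 W * X₁ * (Matrix.fromBlocks W 0 0 W)ᴴ) =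
      Matrix.fromBlocks (diagonal fun k => (ξ k : ℂ)) (diagonal Δ₀) (diagonal Δ₀)ᴴ
        (-diagonal fun k => (ξ k : ℂ)))
    (hX : (N : ℂ)⁻¹ • (Matrix.fromBlocks W 0 0 W * X * (Matrix.fromBlocks W 0 0 W)ᴴ) =
      Matrix.fromBlocks (diagonal fun k => (ξ k : ℂ)) Dh Dhᴴ (-diagonal fun k => (ξ k : ℂ))) :
    (((X₁ - X) * (X₁ * ((N : ℂ)⁻¹ • ((Matrix.fromBlocks W 0 0 W)ᴴ *
        Matrix.fromBlocks (diagonal fun k => (E k : ℂ)) 0 0 (diagonal fun k => (E k : ℂ)) *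
        Matrix.fromBlocks W 0 0 W))⁻¹)).trace).re =
      2 * ∑ k, (‖Δ₀ k‖ ^ 2 - (conj (Δ₀ k) * Dh k k).re) / E k := by
  have h1₂ := fromBlocks_conjTranspose_mul_self (W := W) h1
  have h2₂ := fromBlocks_mul_conjTranspose_self (W := W) h2
  rw [frozenMetric_inv hN h1 h2 E hEne]
  set W₂ : Matrix (m ⊕ m) (m ⊕ m) ℂ := Matrix.fromBlocks W 0 0 W with hW₂
  set Kh : Matrix (m ⊕ m) (m ⊕ m) ℂ :=
    Matrix.fromBlocks (diagonal fun k => ((E k)⁻¹ : ℂ)) 0 0 (diagonal fun k => ((E k)⁻¹ : ℂ))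
    with hKh
  set K : Matrix (m ⊕ m) (m ⊕ m) ℂ := (N : ℂ)⁻¹ • (W₂ᴴ * Kh * W₂) with hKdef
  have hKhat : (N : ℂ)⁻¹ • (W₂ * K * W₂ᴴ) = Kh := hat_unhat hN h2₂ Kh
  -- to momentum space
  rw [← trace_hat hN h1₂ ((X₁ - X) * (X₁ * K)), ← hat_mul hN h1₂, ← hat_mul hN h1₂, hat_sub',
    hKhat, hX₁, hX, hKh]
  rw [fromBlocks_sub', Matrix.fromBlocks_multiply, Matrix.fromBlocks_multiply]
  simp only [sub_self, Matrix.mul_zero, Matrix.zero_mul, add_zero, zero_add]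
  rw [show ∀ (A B C D : Matrix m m ℂ), (Matrix.fromBlocks A B C D).trace = A.trace + D.trace from
    fun A B C D => by simp [Matrix.trace, Fintype.sum_sum_type]]
  rw [Matrix.diagonal_conjTranspose, Matrix.diagonal_mul_diagonal, Matrix.diagonal_mul_diagonal,
    trace_mul_diagonal', trace_mul_diagonal', ← Finset.sum_add_distrib, Complex.re_sum,
    Finset.mul_sum]
  refine Finset.sum_congr rfl fun k _ => ?_
  simp only [Matrix.sub_apply, Matrix.diagonal_apply_eq, Matrix.conjTranspose_apply,
    Pi.star_apply, Complex.star_def, ← Complex.ofReal_inv]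
  rw [Complex.sq_norm, Complex.normSq_apply]
  simp only [Complex.add_re, Complex.mul_re, Complex.mul_im, Complex.sub_re, Complex.sub_im,
    Complex.conj_re, Complex.conj_im, Complex.ofReal_re, Complex.ofReal_im]
  have hk := hEne k
  field_simp
  ring

end Transfer

/-! ### The universal first-order bound for the crux's objects -/

section Typed

variable {L : ℕ} [NeZero L]

/-- **Universal variational ceiling on the phase-rigidity deficit** (the remark
`S(θ) ≥ S(0) - 2κ(L² - |Σ_x u_x|)` of crux idea `sqrt-concavity-multiplier`, made a theorem).
For `μ ∈ (-4,4)`, `Δ₁Δ₂ ≠ 0`, `L ≥ 3`, EVERY texture `θ : (ℤ/L)² → ℝ` and every reference angle `α`: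
`Σ_i|λ_i(Hb(0))| - Σ_i|λ_i(Hb(θ))| ≤ 2 (Σ_k |Δ_k|²/E_k) · (1 - L⁻² Σ_x cos(θ_x - α))`,
`Δ_k = 2Δ₁(cos p₀ - cos p₁) - 4iΔ₂ sin p₀ sin p₁`, `E_k = √(ξ_k² + |Δ_k|²)`. Proof: the trace norm of
`Hb(0)` is at most `Tr |Hb(0)| = 2Σ_k E_k` (metric majorant), the trace norm of `Hb(θ)` is at least
`Re Tr (Hb(θ) sgn Hb(α))` (unitary minorant; `|Hb(α)| = |Hb(0)|`), and in the plane-wave basis only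
the diagonal momentum entries `D^_{kk} = Δ_k · L⁻² Σ_x e^{iθ_x}` of the pairing block meet
`sgn Hb(α)`. The gain from untwisting any texture is thus bounded by a condensation-type constant
times the deficit of the mean order parameter `L⁻² Σ_x e^{i(θ_x - α)}`. [folklore] -/
theorem deficit_le_condensation (μ Δ₁ Δ₂ α : ℝ) (hL : 3 ≤ L) (hμ : μ ∈ Set.Ioo (-4 : ℝ) 4)
    (h₁ : Δ₁ ≠ 0) (h₂ : Δ₂ ≠ 0) (ξ E : TorusSite 2 L → ℝ) (Δ : TorusSite 2 L → ℂ)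
    (hξ : ∀ k, ξ k = -2 * Real.cos (latticeMomentum L k 0) - 2 * Real.cos (latticeMomentum L k 1) - μ)
    (hΔ : ∀ k, Δ k = ((2 * Δ₁ * (Real.cos (latticeMomentum L k 0) - Real.cos (latticeMomentum L k 1)) : ℝ) : ℂ) -
        4 * Complex.I * ((Δ₂ * Real.sin (latticeMomentum L k 0) * Real.sin (latticeMomentum L k 1) : ℝ) : ℂ))
    (hE : ∀ k, E k = Real.sqrt (ξ k ^ 2 + ‖Δ k‖ ^ 2)) :
    let nnx : Literature.Probability.LatticeModels.TorusSite 2 L → Literature.Probability.LatticeModels.TorusSite 2 L → Prop := fun x y => y = x + ![1, 0] ∨ y = x + ![-1, 0]; let nny : Literature.Probability.LatticeModels.TorusSite 2 L → Literature.Probability.LatticeModels.TorusSite 2 L → Prop := fun x y => y = x + ![0, 1] ∨ y = x + ![0, -1]; let dg1 : Literature.Probability.LatticeModels.TorusSite 2 L → Literature.Probability.LatticeModels.TorusSite 2 L → Prop := fun x y => y = x + ![1, 1] ∨ y = x + ![-1, -1]; let dg2 : Literature.Probability.LatticeModels.TorusSite 2 L → Literature.Probability.LatticeModels.TorusSite 2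 L → Prop := fun x y => y = x + ![1, -1] ∨ y = x + ![-1, 1]; let h : Matrix (Literature.Probability.LatticeModels.TorusSite 2 L) (Literature.Probability.LatticeModels.TorusSite 2 L) ℂ := fun x y => -(if nnx x y ∨ nny x y then (1 : ℂ) else 0) - (if x = y then (μ : ℂ) else 0); let D : (Literature.Probability.LatticeModels.TorusSite 2 L → ℝ) → Matrix (Literature.Probability.LatticeModels.TorusSite 2 L) (Literature.Probability.LatticeModels.TorusSite 2 L) ℂ := fun θ x y => ((Δ₁ : ℂ) * ((if nnx x y then (1 : ℂ) else 0) - (if nny x y then (1 : ℂ) else 0)) + Complex.I * (Δ₂ : ℂ) * ((if dg1 x y then (1 : ℂ) else 0) - (if dg2 x y then (1 : ℂ) else 0))) * (Complex.exp (Complex.I * (θ x : ℂ)) + Complex.exp (Complex.I * (θ y : ℂ))) / 2; let Hb : (Literature.Probability.LatticeModels.TorusSite 2 L → ℝ) → Matrix (Literature.Probability.LatticeModels.TorusSite 2 L ⊕ Literature.Probability.LatticeModels.TorusSite 2 L) (Literature.Probability.LatticeModels.TorusSite 2 L ⊕ Literature.Probability.LatticeModels.TorusSite 2 L) ℂ :=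 fun θ => Matrix.fromBlocks h (D θ) (Matrix.conjTranspose (D θ)) (-h); ∀ θ : Literature.Probability.LatticeModels.TorusSite 2 L → ℝ, ∀ (hθ : (Hb θ).IsHermitian) (h0 : (Hb (fun _ => 0)).IsHermitian), ∑ i, |h0.eigenvalues i| - ∑ i, |hθ.eigenvalues i| ≤ 2 * (∑ k, ‖Δ k‖ ^ 2 / E k) * (1 - (∑ x, Real.cos (θ x - α)) / ((L ^ 2 : ℕ) : ℝ)) := by
  intro nnx nny dg1 dg2 h D Hb θ hθ h0
  -- the scaled plane-wave unitary `W` (written out) and `N = L²`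
  have hN : (L ^ 2 : ℕ) ≠ 0 := pow_ne_zero 2 (NeZero.ne L)
  have hNr : ((L ^ 2 : ℕ) : ℝ) ≠ 0 := by exact_mod_cast hN
  have h1 := planeWave_conjTranspose_mul_self (d := 2) (L := L)
  have h2 := planeWave_mul_conjTranspose_self (d := 2) (L := L)
  -- stencils and the texture
  set a : TorusSite 2 L → ℂ := fun r : TorusSite 2 L =>
    -(if ((r = -![1, 0] ∨ r = -![-1, 0]) ∨ (r = -![0, 1] ∨ r = -![0, -1])) then (1 : ℂ) else 0) -
      (if r = 0 then (μ : ℂ) else 0) with ha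
  set dv : TorusSite 2 L → ℂ := fun r : TorusSite 2 L =>
    (Δ₁ : ℂ) * ((if (r = -![1, 0] ∨ r = -![-1, 0]) then (1 : ℂ) else 0) -
      (if (r = -![0, 1] ∨ r = -![0, -1]) then (1 : ℂ) else 0)) +
    Complex.I * (Δ₂ : ℂ) * ((if (r = -![1, 1] ∨ r = -![-1, -1]) then (1 : ℂ) else 0) -
      (if (r = -![1, -1] ∨ r = -![-1, 1]) then (1 : ℂ) else 0)) with hdv
  set u : TorusSite 2 L → ℂ := fun x => Complex.exp (Complex.I * (θ x : ℂ)) with hu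
  -- the gap is open
  have hdisp : ∀ k, 0 < ξ k ^ 2 + ‖Δ k‖ ^ 2 := by
    intro k
    rw [hξ, hΔ]
    exact bdg_dispersion_pos μ Δ₁ Δ₂ _ _ hμ h₁ h₂
  have hEpos : ∀ k, 0 < E k := fun k => by rw [hE]; exact Real.sqrt_pos.2 (hdisp k)
  have hEsq : ∀ k, E k ^ 2 = ξ k ^ 2 + ‖Δ k‖ ^ 2 := fun k => by
    rw [hE, Real.sq_sqrt (hdisp k).le]
  -- symbols
  have hFa : torusFourier a = fun k => (ξ k : ℂ) := by
    funext k
    rw [ha, torusFourier_hopVec hL μ k, hξ]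
  have hFd : torusFourier dv = Δ := by
    funext k
    rw [hdv, torusFourier_pairVec hL Δ₁ Δ₂ k, hΔ]
  -- the crux's matrices in structured form
  have hh : h = Matrix.circulant a := hopping_eq_circulant μ
  have hDθ : D θ = (1 / 2 : ℂ) • (Matrix.diagonal u * Matrix.circulant dv +
      Matrix.circulant dv * Matrix.diagonal u) := pairing_eq_anticommutator Δ₁ Δ₂ θ
  have hD0 : D (fun _ => 0) = Matrix.circulant dv := by
    have key := pairing_eq_anticommutator (L := L) Δ₁ Δ₂ (fun _ => (0 : ℝ))
    rw [← hdv] at key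
    change D (fun _ => 0) = _ at key
    rw [key]
    have hu0 : (Matrix.diagonal fun _ : TorusSite 2 L => Complex.exp (Complex.I * ((0 : ℝ) : ℂ))) = 1 := by
      rw [Complex.ofReal_zero, mul_zero, Complex.exp_zero]; exact Matrix.diagonal_one
    rw [hu0, Matrix.one_mul, Matrix.mul_one, ← two_smul ℂ (Matrix.circulant dv), smul_smul,
      show (1 / 2 : ℂ) * 2 = 1 by norm_num, one_smul]
  -- plane-wave (hat) forms of the blocks
  have hath : ((L ^ 2 : ℕ) : ℂ)⁻¹ • (Matrix.of (fun k x : TorusSite 2 L => conj (torusChar k x)) * h *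
      (Matrix.of fun k x : TorusSite 2 L => conj (torusChar k x))ᴴ) = Matrix.diagonal (fun k => (ξ k : ℂ)) := by
    rw [hh, hat_circulant, hFa]
  have hatC : ((L ^ 2 : ℕ) : ℂ)⁻¹ • (Matrix.of (fun k x : TorusSite 2 L => conj (torusChar k x)) *
      Matrix.circulant dv * (Matrix.of fun k x : TorusSite 2 L => conj (torusChar k x))ᴴ) =
      Matrix.diagonal Δ := by
    rw [hat_circulant, hFd]
  have hatCh : ((L ^ 2 : ℕ) : ℂ)⁻¹ • (Matrix.of (fun k x : TorusSite 2 L => conj (torusChar k x)) *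
      (Matrix.circulant dv)ᴴ * (Matrix.of fun k x : TorusSite 2 L => conj (torusChar k x))ᴴ) =
      (Matrix.diagonal Δ)ᴴ := by
    rw [hat_conjTranspose, hatC]
  have hatnegh : ((L ^ 2 : ℕ) : ℂ)⁻¹ • (Matrix.of (fun k x : TorusSite 2 L => conj (torusChar k x)) * (-h) *
      (Matrix.of fun k x : TorusSite 2 L => conj (torusChar k x))ᴴ) = -Matrix.diagonal (fun k => (ξ k : ℂ)) := by
    rw [Matrix.mul_neg, Matrix.neg_mul, smul_neg, hath]
  set Dh : Matrix (TorusSite 2 L) (TorusSite 2 L) ℂ := ((L ^ 2 : ℕ) : ℂ)⁻¹ •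
    (Matrix.of (fun k x : TorusSite 2 L => conj (torusChar k x)) * D θ *
      (Matrix.of fun k x : TorusSite 2 L => conj (torusChar k x))ᴴ) with hDhdef
  have hatDθh : ((L ^ 2 : ℕ) : ℂ)⁻¹ • (Matrix.of (fun k x : TorusSite 2 L => conj (torusChar k x)) *
      (D θ)ᴴ * (Matrix.of fun k x : TorusSite 2 L => conj (torusChar k x))ᴴ) = Dhᴴ :=
    hat_conjTranspose (D θ)
  have hX₀ : ((L ^ 2 : ℕ) : ℂ)⁻¹ • (Matrix.fromBlocks (Matrix.of (fun k x : TorusSite 2 L => conj (torusChar k x))) 0 0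
        (Matrix.of (fun k x : TorusSite 2 L => conj (torusChar k x))) * Hb (fun _ => 0) *
      (Matrix.fromBlocks (Matrix.of (fun k x : TorusSite 2 L => conj (torusChar k x))) 0 0
        (Matrix.of (fun k x : TorusSite 2 L => conj (torusChar k x))))ᴴ) =
      Matrix.fromBlocks (Matrix.diagonal fun k => (ξ k : ℂ)) (Matrix.diagonal Δ) (Matrix.diagonal Δ)ᴴ
        (-Matrix.diagonal fun k => (ξ k : ℂ)) := by
    change ((L ^ 2 : ℕ) : ℂ)⁻¹ • (Matrix.fromBlocks (Matrix.of (fun k x : TorusSite 2 L => conj (torusChar k x))) 0 0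
        (Matrix.of (fun k x : TorusSite 2 L => conj (torusChar k x))) *
        Matrix.fromBlocks h (D (fun _ => 0)) (D (fun _ => 0))ᴴ (-h) *
      (Matrix.fromBlocks (Matrix.of (fun k x : TorusSite 2 L => conj (torusChar k x))) 0 0
        (Matrix.of (fun k x : TorusSite 2 L => conj (torusChar k x))))ᴴ) = _
    rw [hat_fromBlocks, hD0, hath, hatC, hatCh, hatnegh]
  have hX : ((L ^ 2 : ℕ) : ℂ)⁻¹ • (Matrix.fromBlocks (Matrix.of (fun k x : TorusSite 2 L => conj (torusChar k x))) 0 0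
        (Matrix.of (fun k x : TorusSite 2 L => conj (torusChar k x))) * Hb θ *
      (Matrix.fromBlocks (Matrix.of (fun k x : TorusSite 2 L => conj (torusChar k x))) 0 0
        (Matrix.of (fun k x : TorusSite 2 L => conj (torusChar k x))))ᴴ) =
      Matrix.fromBlocks (Matrix.diagonal fun k => (ξ k : ℂ)) Dh Dhᴴ (-Matrix.diagonal fun k => (ξ k : ℂ)) := by
    change ((L ^ 2 : ℕ) : ℂ)⁻¹ • (Matrix.fromBlocks (Matrix.of (fun k x : TorusSite 2 L => conj (torusChar k x))) 0 0
        (Matrix.of (fun k x : TorusSite 2 L => conj (torusChar k x))) *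
        Matrix.fromBlocks h (D θ) (D θ)ᴴ (-h) *
      (Matrix.fromBlocks (Matrix.of (fun k x : TorusSite 2 L => conj (torusChar k x))) 0 0
        (Matrix.of (fun k x : TorusSite 2 L => conj (torusChar k x))))ᴴ) = _
    rw [hat_fromBlocks, hath, hatDθh, hatnegh]
  -- the rotated constant reference `Hb(α)`: pairing block `c • C`, `c = e^{iα}`
  set c : ℂ := Complex.exp (Complex.I * (α : ℂ)) with hc
  have hcn : ‖c‖ = 1 := by rw [hc, mul_comm, Complex.norm_exp_ofReal_mul_I]
  have hdiagc : (Matrix.diagonal fun _ : TorusSite 2 L => Complex.exp (Complex.I * ((α : ℝ) : ℂ))) =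
      c • (1 : Matrix (TorusSite 2 L) (TorusSite 2 L) ℂ) := by
    ext i j
    rw [Matrix.diagonal_apply, Matrix.smul_apply, Matrix.one_apply, smul_eq_mul, mul_ite, mul_one,
      mul_zero]
  have hDα : D (fun _ => α) = c • Matrix.circulant dv := by
    have key := pairing_eq_anticommutator (L := L) Δ₁ Δ₂ (fun _ => α)
    rw [← hdv] at key
    change D (fun _ => α) = _ at key
    rw [key, hdiagc, Matrix.smul_mul, Matrix.mul_smul, Matrix.one_mul, Matrix.mul_one, ← two_smul ℂ,
      smul_smul, smul_smul, show (1 / 2 : ℂ) * 2 * c = c by ring]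
  have hatCα : ((L ^ 2 : ℕ) : ℂ)⁻¹ • (Matrix.of (fun k x : TorusSite 2 L => conj (torusChar k x)) *
      (c • Matrix.circulant dv) * (Matrix.of fun k x : TorusSite 2 L => conj (torusChar k x))ᴴ) =
      Matrix.diagonal (fun k => c * Δ k) := by
    rw [Matrix.mul_smul, Matrix.smul_mul, smul_comm, hatC, ← Matrix.diagonal_smul]
    rfl
  have hatCαh : ((L ^ 2 : ℕ) : ℂ)⁻¹ • (Matrix.of (fun k x : TorusSite 2 L => conj (torusChar k x)) *
      (c • Matrix.circulant dv)ᴴ * (Matrix.of fun k x : TorusSite 2 L => conj (torusChar k x))ᴴ) =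
      (Matrix.diagonal fun k => c * Δ k)ᴴ := by
    rw [hat_conjTranspose, hatCα]
  have hX₁ : ((L ^ 2 : ℕ) : ℂ)⁻¹ • (Matrix.fromBlocks (Matrix.of (fun k x : TorusSite 2 L => conj (torusChar k x))) 0 0
        (Matrix.of (fun k x : TorusSite 2 L => conj (torusChar k x))) * Hb (fun _ => α) *
      (Matrix.fromBlocks (Matrix.of (fun k x : TorusSite 2 L => conj (torusChar k x))) 0 0
        (Matrix.of (fun k x : TorusSite 2 L => conj (torusChar k x))))ᴴ) =
      Matrix.fromBlocks (Matrix.diagonal fun k => (ξ k : ℂ)) (Matrix.diagonal fun k => c * Δ k)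
        (Matrix.diagonal fun k => c * Δ k)ᴴ (-Matrix.diagonal fun k => (ξ k : ℂ)) := by
    change ((L ^ 2 : ℕ) : ℂ)⁻¹ • (Matrix.fromBlocks (Matrix.of (fun k x : TorusSite 2 L => conj (torusChar k x))) 0 0
        (Matrix.of (fun k x : TorusSite 2 L => conj (torusChar k x))) *
        Matrix.fromBlocks h (D (fun _ => α)) (D (fun _ => α))ᴴ (-h) *
      (Matrix.fromBlocks (Matrix.of (fun k x : TorusSite 2 L => conj (torusChar k x))) 0 0
        (Matrix.of (fun k x : TorusSite 2 L => conj (torusChar k x))))ᴴ) = _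
    rw [hat_fromBlocks, hDα, hath, hatCα, hatCαh, hatnegh]
  -- Hermiticity of the rotated reference (from `h0`, which pins `hᴴ = h`)
  have hh11 : h.IsHermitian := (Matrix.isHermitian_fromBlocks_iff.1 h0).1
  have hα : (Hb fun _ => α).IsHermitian := by
    change (Matrix.fromBlocks h (D (fun _ => α)) (D (fun _ => α))ᴴ (-h)).IsHermitian
    exact Matrix.IsHermitian.fromBlocks hh11 rfl hh11.neg
  -- the frozen metric: `M ≻ 0`, `M² = Hb(0)² = Hb(α)²`, `[Hb(α), M] = 0`
  have hM := frozenMetric_posDef hN h1 E hEpos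
  obtain ⟨-, hsq₀⟩ := frozenMetric_comm_and_sq hN h1 h2 ξ E Δ hEsq (Hb fun _ => 0) hX₀
  have hEsqα : ∀ k, E k ^ 2 = ξ k ^ 2 + ‖c * Δ k‖ ^ 2 := fun k => by
    rw [norm_mul, hcn, one_mul]; exact hEsq k
  obtain ⟨hcomm₁, hsq₁⟩ := frozenMetric_comm_and_sq hN h1 h2 ξ E (fun k => c * Δ k) hEsqα
    (Hb fun _ => α) hX₁
  have hdef := deficit_le_re_trace_first_order (Hb fun _ => 0) (Hb fun _ => α) (Hb θ) _ h0 hα hθ hM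
    hsq₀ hcomm₁ hsq₁
  have hEne : ∀ k, E k ≠ 0 := fun k => (hEpos k).ne'
  rw [firstOrder_re_trace hN h1 h2 ξ E (fun k => c * Δ k) hEne (Hb fun _ => α) (Hb θ) Dh hX₁ hX]
    at hdef
  -- the diagonal of the pairing block: `D^_{kk} = N⁻¹ (Σ_x u_x) Δ_k`
  have hDhkk : ∀ k, Dh k k = (((L ^ 2 : ℕ) : ℝ) : ℂ)⁻¹ * (∑ x, u x) * Δ k := by
    intro k
    rw [hDhdef, hDθ, hat_pairing_apply u dv k k, hFd, sub_self]
    simp only [torusChar_zero_left, mul_one]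
    push_cast
    ring
  -- its pairing with `conj (c Δ_k)`
  set mθ : ℝ := ((L ^ 2 : ℕ) : ℝ)⁻¹ * ∑ x, Real.cos (θ x - α) with hmθ
  have hre : ∀ k, (conj (c * Δ k) * Dh k k).re = ‖Δ k‖ ^ 2 * mθ := by
    intro k
    rw [hDhkk]
    have hnorm : conj (Δ k) * Δ k = (((‖Δ k‖ ^ 2 : ℝ)) : ℂ) := by
      rw [mul_comm, Complex.mul_conj, Complex.normSq_eq_norm_sq]
    have hcu : ∀ x, conj c * u x = Complex.exp (((θ x - α : ℝ) : ℂ) * Complex.I) := by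
      intro x
      rw [hc, hu]
      dsimp only
      rw [← Complex.exp_conj, map_mul, Complex.conj_I, Complex.conj_ofReal, ← Complex.exp_add]
      congr 1
      push_cast
      ring
    have hprod : conj (c * Δ k) * ((((L ^ 2 : ℕ) : ℝ) : ℂ)⁻¹ * (∑ x, u x) * Δ k) =
        ((((L ^ 2 : ℕ) : ℝ)⁻¹ * ‖Δ k‖ ^ 2 : ℝ) : ℂ) *
          ∑ x, Complex.exp (((θ x - α : ℝ) : ℂ) * Complex.I) := by
      rw [map_mul]
      simp only [Finset.mul_sum, Finset.sum_mul]
      refine Finset.sum_congr rfl fun x _ => ?_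
      rw [← hcu x, Complex.ofReal_mul, Complex.ofReal_inv, ← hnorm]
      ring
    rw [hprod, Complex.re_ofReal_mul, Complex.re_sum]
    simp_rw [Complex.exp_ofReal_mul_I_re]
    rw [hmθ]
    ring
  have hterm : ∀ k, (‖c * Δ k‖ ^ 2 - (conj (c * Δ k) * Dh k k).re) / E k =
      ‖Δ k‖ ^ 2 / E k * (1 - mθ) := by
    intro k
    rw [hre, norm_mul, hcn, one_mul]
    ring
  simp_rw [hterm, ← Finset.sum_mul] at hdef
  have hm : (∑ x, Real.cos (θ x - α)) / ((L ^ 2 : ℕ) : ℝ) = mθ := by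
    rw [hmθ, div_eq_inv_mul]
  rw [hm]
  linarith

end Typed

end BirBdG

end Summit.HubbardSuperconductivity.HubbardSuperconductivity.Theorems

end
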